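import Summits.BirchSwinnertonDyer.BirchSwinnertonDyer.Theorems.PublishedInputsGreenbergLemma34KernelCoinvariants
import Summits.BirchSwinnertonDyer.BirchSwinnertonDyer.Theorems.PublishedInputsGreenbergLayerCocycles
import Literature.NumberTheory.EllipticCurves.AnticyclotomicSignedLocalConditions
import HarnessLib

set_option linter.dupNamespace false -- `…BirchSwinnertonDyer.BirchSwinnertonDyer…` is the cell's nested layout (D-0017)
set_option autoImplicit false

/-!
# Greenberg LNM 1716 Lemma 3.4 at the layers, brick 4′: the ISOMORPHISM `𝒦_{E,n}[p^∞] ≅ (E(K_{∞,η})/(g^{pⁿ} − 1))[p^∞]`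
# (additive-equivalence form of brick 4's count, for the STRUCTURE of `ker(r_{v_n})`)

Seat `bsd-inputs-k4-p1` (gen 6; LADDER-BSD D-0154 KEY (147)(f) «prove the printed input», row 1 K4 INPUTS; Greenberg
1999), `--supports stmt-BirchSwinnertonDyer-20309`. THEOREMS ONLY (no definition, no named fact, no `sorry`).

R. Greenberg, *Iwasawa theory for elliptic curves*, LNM 1716 (1999), §3 (pp. 86–89): `ker(r_{v_n}) ≅ H¹(Γ_{v_n}, E(K_{∞,η}))`
with `Γ_{v_n} = Gal(K_{∞,η}/K_{n,v_n}) ≅ pⁿℤ_p` pro-cyclic on `γ_{v_n}`, so `#ker(r_{v_n})[p^∞] = #(E(K_{∞,η})/(γ_{v_n} − 1))[p^∞]`.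
Gen 5 proved this at the layer `n = 0` (`InputsGreenbergLemma34.natCard_localTowerKerPrimary_zero_eq_of_isTopGenerator`);
cell bsd-2adic has the INJECTION at every layer (BRICK 11). This file is the EQUALITY at every layer `n`, for a
`ℤ_p`-extension `κ` of `K` whose localisation `κ ∘ res : Γ_E → Γ_K → ℤ_p` to the `K`-field `E` is still surjective
(`ZpExtension.localize`; for `E = ℚ_v`, `v ∣ p`, `κ` cyclotomic this is total ramification of `p` in `ℚ_∞`) and a
topological generator `g` of the localised extension: the generator of the layer `n` is `g^{pⁿ}`. Ingredients: gen 5's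
generic count `natCard_primary_subgroupResKer_eq_of_cocycles` on the open subgroup `H_{E,n} = Gal(K̄_E/K_n E)`, the
identification `𝒦_{E,n} = ker(res : H¹(H_{E,n}, E(K̄_E)) → H¹(H_{E,∞}, ·))`, and the layer-`n` inflation cocycles
(`InputsGreenbergLemma34Layer.exists_layerCocycle_vanishing_apply_eq_of_nsmul_eq_sub`).

* `addEquiv_primary_subgroupResKer_of_cocycles` — generic: the tree's injective evaluation map
  (`exists_addMonoidHom_subgroupResKer_injective`) is an additive ISOMORPHISM from the `p`-primary part of
  `ker(res : H¹(G,M) → H¹(N,M))` onto `(M^N/(γ−1)M^N)[p^∞]`, given inflation cocycles for torsion classes (gen 5 / brick 4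
  recorded only the equality of cardinalities).
* **`nonempty_addEquiv_localTowerKerPrimary`** — `𝒦_{E,n}[p^∞] ≃+ (E(K̄_E)^{H_{E,∞}}/(g^{pⁿ} − 1))[p^∞]` at every layer `n`
  (brick 4 gave `#𝒦_{E,n}[p^∞] = #(…)`; the structure fact `lemma34_localTowerKerPrimary_cyclicExtension_rat` needs the
  group isomorphism).

HONEST FRAMING: TOOL theorem; closes nothing; no summit statement is proved; BSD is not proved by any of this.

References: [GreenbergLNM1716] §3 Lemmas 3.1–3.4 (pp. 86–89); [SerreGaloisCohomology1997] I.§2.6, XIII.§1;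
[HatleyLeiVigni2022] §3.1 (localised `ℤ_p`-extension).
-/

noncomputable section

open scoped Classical

universe u

namespace Summit.BirchSwinnertonDyer.BirchSwinnertonDyer.Theorems.InputsGreenbergLemma34Layer

open Literature.NumberTheory.EllipticCurves Literature.NumberTheory.GaloisRepresentations
  Literature.NumberTheory.EllipticCurves.ResKernel Literature.NumberTheory.EllipticCurves.PrimaryCoinvariants
  Literature.NumberTheory.EllipticCurves.LayerCocycle ZpExtension WeierstrassCurve
  Summit.BirchSwinnertonDyer.BirchSwinnertonDyer.Theorems.InputsGreenbergLemma34


/-! ## §1 Generic: the `p`-primary evaluation ISOMORPHISM -/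

section Generic

variable {G : Type u} [Group G] [TopologicalSpace G] [IsTopologicalGroup G]
  (N : Subgroup G) [N.Normal] (M : Type u) [AddCommGroup M] [DistribMulAction G M]
  [TopologicalSpace M] [DiscreteTopology M]

/-- **`ker(res : H¹(G,M) → H¹(N,M))[p^∞] ≃+ (M^N/(γ−1)M^N)[p^∞]`** when `N` and `γ` generate `G` topologically and every
`b ∈ M^N` whose class is `p`-power torsion is `ψ(γ)` for a continuous cocycle `ψ` on `G` vanishing on `N`: the injective
evaluation homomorphism of the tree (`exists_addMonoidHom_subgroupResKer_injective`) restricted to the `p`-primary parts is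
onto (gen 5's `natCard_primary_subgroupResKer_eq_of_cocycles`, recorded here as an additive equivalence).
[cite: GreenbergLNM1716, §3 Lemmas 3.1 and 3.3 (pp. 86–87)] [cite: SerreGaloisCohomology1997, XIII.§1] -/
theorem addEquiv_primary_subgroupResKer_of_cocycles (γ : G)
    (hgen : ∀ U : Subgroup G, IsOpen (U : Set G) → N ≤ U → γ ∈ U → U = ⊤)
    (hcont : ∀ m : M, Continuous fun g : G ↦ g • m) (p : ℕ)
    (hinf : ∀ b : FixedPoints.addSubgroup N M,
      (∃ k : ℕ, p ^ k • (QuotientAddGroup.mk b : FixedPoints.addSubgroup N M ⧸ (subOne N M γ).range) = 0) →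
      ∃ ψ : contOneCocycles (discreteTopRep G M), (∀ n ∈ N, ψ.1 n = 0) ∧ ψ.1 γ = b) :
    Nonempty (AddCommGroup.primaryComponent (subgroupResKer M N) p ≃+
      AddCommGroup.primaryComponent (FixedPoints.addSubgroup N M ⧸ (subOne N M γ).range) p) := by
  -- adapted from Summits/.../Theorems/PublishedInputsGreenbergLemma34InflationCocycles.lean (gen 5, §1)
  obtain ⟨w, hw, hwval⟩ := exists_addMonoidHom_subgroupResKer_injective N M γ hgen hcont
  let f : AddCommGroup.primaryComponent (subgroupResKer M N) p →+
      AddCommGroup.primaryComponent (FixedPoints.addSubgroup N M ⧸ (subOne N M γ).range) p :=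
    { toFun := fun x ↦ ⟨w x.1, by
        obtain ⟨k, hk⟩ := (AddCommGroup.mem_primaryComponent).mp x.2
        exact (AddCommGroup.mem_primaryComponent).mpr ⟨k, by rw [← map_nsmul, hk, map_zero]⟩⟩
      map_zero' := Subtype.ext (by simp)
      map_add' := fun x y ↦ Subtype.ext (by simp) }
  have hf : Function.Injective f := fun x y hxy ↦ Subtype.ext (hw (Subtype.ext_iff.mp hxy))
  have hfsurj : Function.Surjective f := by
    rintro ⟨q, hq⟩
    obtain ⟨k, hk⟩ := (AddCommGroup.mem_primaryComponent).mp hq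
    obtain ⟨b, rfl⟩ := QuotientAddGroup.mk_surjective q
    obtain ⟨ψ, hψN, hψγ⟩ := hinf b ⟨k, hk⟩
    have hmem : oneCocycleClass _ ψ ∈ subgroupResKer M N := by
      rw [mem_subgroupResKer_iff, ResKernel.resSubgroup_oneCocycleClass]
      have h0 : contOneCocycles.pullback (Literature.NumberTheory.EllipticCurves.subgroupIncl N)
          (resHomOfEquivariant (Literature.NumberTheory.EllipticCurves.subgroupIncl N) (AddMonoidHom.id M)
            (fun _ _ ↦ rfl)) ψ = 0 := by
        apply Subtype.ext
        ext n
        rw [pullback_subtype_apply]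
        exact hψN n n.2
      rw [h0, oneCocycleClass_zero]
    have hwx : w ⟨_, hmem⟩ = QuotientAddGroup.mk b := by
      rw [hwval ⟨_, hmem⟩ ψ hψN rfl]
      exact congrArg _ (Subtype.ext hψγ)
    have htors : (⟨_, hmem⟩ : subgroupResKer M N) ∈ AddCommGroup.primaryComponent (subgroupResKer M N) p :=
      (AddCommGroup.mem_primaryComponent).mpr ⟨k, hw (by rw [map_nsmul, map_zero, hwx, hk])⟩
    exact ⟨⟨⟨_, hmem⟩, htors⟩, Subtype.ext hwx⟩
  exact ⟨AddEquiv.ofBijective f ⟨hf, hfsurj⟩⟩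

end Generic

/-! ## §2 The local tower kernel at the layer `n` -/

variable {E : Type u} [Field E] [CharZero E] {p : ℕ} [hp : Fact p.Prime]
  {K : Type u} [Field K] (W : WeierstrassCurve K) (κ : ZpExtension K p) [Algebra K E]

set_option maxHeartbeats 800000 in
/-- **`𝒦_{E,n}[p^∞] ≃+ (E(K̄_E)^{H_{E,∞}}/(g^{pⁿ} − 1))[p^∞]` at EVERY layer `n`** (elliptic `W/K`, `κ` a
`ℤ_p`-extension of `K` whose localisation `κ ∘ res_E` is onto, `g` a topological generator of `κ.localize`): the
additive-equivalence form of brick 4 (`natCard_localTowerKerPrimary_eq_of_isTopGenerator`). Greenberg, LNM 1716, §3: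
"`ker(r_{v_n}) ≅ H¹(Γ_{v_n}, E(K_{∞,η}))`". [cite: GreenbergLNM1716, §3 Lemmas 3.3–3.4 (pp. 86–89)]
[cite: SerreGaloisCohomology1997, I.§2.6, XIII.§1] -/
theorem nonempty_addEquiv_localTowerKerPrimary
    (h : Function.Surjective (κ.toContinuousMonoidHom.comp (resGal (K := K) E)))
    {g : Field.absoluteGaloisGroup E} (hγ : (κ.localize (closureEmb (K := K) E) h).IsTopGenerator g) (n : ℕ) :
    Nonempty (W.localTowerKerPrimary κ E n ≃+
      AddCommGroup.primaryComponent
        (FixedPoints.addSubgroup (localSubgroup κ.kerSubgroup E) (localPoints W E) ⧸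
          (subOne (localSubgroup κ.kerSubgroup E) (localPoints W E) (g ^ p ^ n)).range) p) := by
  -- adapted from Summits/.../Theorems/PublishedInputsGreenbergLayerKernelCoinvariants.lean (brick 4)
  -- notation (as in the tree's `finite_localTowerKerPrimary_and_card_le`)
  let κE : ZpExtension E p := κ.localize (closureEmb (K := K) E) h
  let P : Type u := localPoints W E
  let Hn : Subgroup (Field.absoluteGaloisGroup E) := localSubgroup (κ.layerSubgroup n) E
  let Hi : Subgroup (Field.absoluteGaloisGroup E) := localSubgroup κ.kerSubgroup E
  let N : Subgroup Hn := Hi.subgroupOf Hn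
  -- the localised extension has `ker κE = H_{E,∞}` and `κE⁻¹(pⁿℤ_p) = H_{E,n}` (definitionally)
  have hker : κE.kerSubgroup = Hi := rfl
  have hlay : κE.layerSubgroup n = Hn := rfl
  have hg : g ^ p ^ n ∈ Hn := hlay ▸ pow_mem_layerSubgroup κE hγ n
  let γ : Hn := ⟨g ^ p ^ n, hg⟩
  have hle : Hi ≤ Hn := WeierstrassCurve.localSubgroup_ker_le_layer κ E n
  -- (1) generation inside `H_{E,n}` (from `κE`)
  have hgen : ∀ U : Subgroup (Field.absoluteGaloisGroup E),
      IsOpen (U : Set (Field.absoluteGaloisGroup E)) → Hi ≤ U → g ^ p ^ n ∈ U → Hn ≤ U := by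
    intro U hU hNU hgU
    exact hlay ▸ κE.layerSubgroup_le_of_isOpen hγ n U hU (hker ▸ hNU) hgU
  have hgen' : ∀ U : Subgroup Hn, IsOpen (U : Set Hn) → N ≤ U → γ ∈ U → U = ⊤ := by
    intro U hU hNU hγU
    let U' : Subgroup (Field.absoluteGaloisGroup E) := U.map Hn.subtype
    have hopen : IsOpen (U' : Set (Field.absoluteGaloisGroup E)) :=
      (isOpen_localSubgroup_layerSubgroup E κ n).isOpenMap_subtype_val _ hU
    have hN' : Hi ≤ U' := fun τ hτ ↦
      ⟨⟨τ, hle hτ⟩, hNU (Subgroup.mem_subgroupOf.mpr hτ), rfl⟩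
    have hγU' : g ^ p ^ n ∈ U' := ⟨γ, hγU, rfl⟩
    have hle' := hgen U' hopen hN' hγU'
    rw [eq_top_iff]
    intro x _
    obtain ⟨u, hu, hux⟩ := hle' x.2
    have : u = x := Subtype.ext hux
    exact this ▸ hu
  -- (2) orbit maps on `H_{E,n}`
  have hcont : ∀ m : P, Continuous fun x : Hn ↦ x • m := fun m ↦
    (continuous_smul_localPoints W E m).comp continuous_subtype_val
  -- (3) `P^N = P^{H_{E,∞}}`, compatibly with `g^{pⁿ} − 1` and `p`-power torsion
  have hfix : FixedPoints.addSubgroup N P = FixedPoints.addSubgroup Hi P := by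
    ext m
    simp only [FixedPoints.mem_addSubgroup]
    constructor
    · intro h' τ
      exact h' ⟨⟨τ, hle τ.2⟩, Subgroup.mem_subgroupOf.mpr τ.2⟩
    · intro h' x
      exact h' ⟨((x : Hn) : Field.absoluteGaloisGroup E), Subgroup.mem_subgroupOf.mp x.2⟩
  let e : FixedPoints.addSubgroup N P ≃+ FixedPoints.addSubgroup Hi P :=
    AddEquiv.addSubgroupCongr hfix
  have he : AddSubgroup.map (e : FixedPoints.addSubgroup N P →+ FixedPoints.addSubgroup Hi P)
      (subOne N P γ).range = (subOne Hi P (g ^ p ^ n)).range := by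
    ext b
    constructor
    · rintro ⟨x, ⟨y, rfl⟩, rfl⟩
      exact ⟨e y, Subtype.ext rfl⟩
    · rintro ⟨y, rfl⟩
      exact ⟨subOne N P γ (e.symm y), ⟨e.symm y, rfl⟩, Subtype.ext rfl⟩
  let eq : FixedPoints.addSubgroup N P ⧸ (subOne N P γ).range ≃+
      FixedPoints.addSubgroup Hi P ⧸ (subOne Hi P (g ^ p ^ n)).range :=
    QuotientAddGroup.congr _ _ e he
  let ep : AddCommGroup.primaryComponent (FixedPoints.addSubgroup N P ⧸ (subOne N P γ).range) p ≃+
      AddCommGroup.primaryComponent (FixedPoints.addSubgroup Hi P ⧸ (subOne Hi P (g ^ p ^ n)).range) p :=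
    { toFun := fun a ↦ ⟨eq a.1, by
        obtain ⟨k, hk⟩ := (AddCommGroup.mem_primaryComponent).mp a.2
        exact (AddCommGroup.mem_primaryComponent).mpr ⟨k, by rw [← map_nsmul, hk, map_zero]⟩⟩
      invFun := fun b ↦ ⟨eq.symm b.1, by
        obtain ⟨k, hk⟩ := (AddCommGroup.mem_primaryComponent).mp b.2
        exact (AddCommGroup.mem_primaryComponent).mpr ⟨k, by rw [← map_nsmul, hk, map_zero]⟩⟩
      left_inv := fun a ↦ Subtype.ext (eq.symm_apply_apply a.1)
      right_inv := fun b ↦ Subtype.ext (eq.apply_symm_apply b.1)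
      map_add' := fun a b ↦ Subtype.ext (by simp) }
  -- (hinf): inflation cocycles on `H_{E,n}` for torsion classes, from `κE` (brick 3)
  have hinfN : ∀ b : FixedPoints.addSubgroup N P,
      (∃ k : ℕ, p ^ k • (QuotientAddGroup.mk b : FixedPoints.addSubgroup N P ⧸ (subOne N P γ).range) = 0) →
      ∃ ψ : contOneCocycles (discreteTopRep Hn P), (∀ n ∈ N, ψ.1 n = 0) ∧ ψ.1 γ = b := by
    rintro b ⟨k, hk⟩
    rw [← QuotientAddGroup.mk_nsmul, QuotientAddGroup.eq_zero_iff] at hk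
    obtain ⟨y, hy⟩ := hk
    have hbk : p ^ k • (b : P) = (g ^ p ^ n) • (y : P) - y := by
      have h' := congrArg (fun z : FixedPoints.addSubgroup N P ↦ (z : P)) hy
      simp only [coe_subOne_apply, AddSubmonoidClass.coe_nsmul] at h'
      exact h'.symm
    have hbfix : ∀ τ ∈ κE.kerSubgroup, τ • (b : P) = b := fun τ hτ ↦ (e b).2 ⟨τ, hker ▸ hτ⟩
    have hyfix : ∀ τ ∈ κE.kerSubgroup, τ • (y : P) = y := fun τ hτ ↦ (e y).2 ⟨τ, hker ▸ hτ⟩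
    obtain ⟨ψ, hψN, hψg⟩ := exists_layerCocycle_vanishing_apply_eq_of_nsmul_eq_sub κE hγ n
      (continuous_smul_localPoints W E) (b : P) hbfix hyfix hbk
    refine ⟨ψ, fun x hx ↦ hψN x (hker ▸ Subgroup.mem_subgroupOf.mp hx), hψg⟩
  -- (4) the generic isomorphism on `H_{E,n}`
  obtain ⟨e₀⟩ := addEquiv_primary_subgroupResKer_of_cocycles N P γ hgen' hcont p hinfN
  -- (5) `𝒦_{E,n} = ker (res : H¹(H_{E,n}, P) → H¹(N, P))`
  let j : N →ₜ* Hi :=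
    { toFun := fun x ↦ ⟨((x : Hn) : Field.absoluteGaloisGroup E), Subgroup.mem_subgroupOf.mp x.2⟩
      map_one' := rfl
      map_mul' := fun _ _ ↦ rfl
      continuous_toFun :=
        (continuous_subtype_val.comp continuous_subtype_val).subtype_mk _ }
  have hcomp : (resH1Hom j (AddMonoidHom.id P) (fun _ _ ↦ rfl)).comp
      (Literature.NumberTheory.EllipticCurves.resOfLe P hle) = resSubgroup N P := by
    unfold Literature.NumberTheory.EllipticCurves.resOfLe ResKernel.resSubgroup
    rw [resH1Hom_comp]
    exact resH1Hom_congr (ContinuousMonoidHom.ext fun _ ↦ rfl) (AddMonoidHom.ext fun _ ↦ rfl) _ _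
  have hkerEq : W.localTowerKer κ E n = subgroupResKer P N := by
    apply le_antisymm
    · intro c hc
      rw [mem_subgroupResKer_iff, ← hcomp, AddMonoidHom.comp_apply,
        (W.mem_localTowerKer_iff κ E n c).mp hc, map_zero]
    · intro c hc
      obtain ⟨φ, rfl, hφN⟩ := exists_cocycle_of_res_eq_zero N P hcont c hc
      rw [W.mem_localTowerKer_iff κ E n]
      change Literature.NumberTheory.EllipticCurves.resOfLe P hle (oneCocycleClass _ φ) = 0
      have h0 : oneCocycleClass _ (contOneCocycles.pullback (subgroupInclusion hle)
          (resHomOfEquivariant (subgroupInclusion hle) (AddMonoidHom.id P) (fun _ _ ↦ rfl)) φ) = 0 := by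
        rw [oneCocycleClass_eq_zero_iff]
        refine ⟨0, fun τ ↦ ?_⟩
        rw [map_zero, sub_zero, contOneCocycles.pullback_apply]
        exact hφN ⟨(τ : Field.absoluteGaloisGroup E), hle τ.2⟩ (Subgroup.mem_subgroupOf.mpr τ.2)
      rw [← map_oneCocycleClass] at h0
      exact h0
  -- (6) `𝒦_{E,n}[p^∞] ≃+ ker(res)[p^∞]`, then compose
  let f : W.localTowerKerPrimary κ E n ≃+ AddCommGroup.primaryComponent (subgroupResKer P N) p :=
    { toFun := fun c ↦ ⟨⟨(c : discreteH1 Hn P), hkerEq.le ((W.mem_localTowerKerPrimary_iff κ E n _).mp c.2).1⟩,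
        (AddCommGroup.mem_primaryComponent).mpr (by
          obtain ⟨k, hk⟩ := ((W.mem_localTowerKerPrimary_iff κ E n _).mp c.2).2
          exact ⟨k, Subtype.ext hk⟩)⟩
      invFun := fun x ↦ ⟨((x.1 : subgroupResKer P N) : discreteH1 Hn P),
        (W.mem_localTowerKerPrimary_iff κ E n _).mpr ⟨hkerEq.symm.le x.1.2, by
          obtain ⟨k, hk⟩ := (AddCommGroup.mem_primaryComponent).mp x.2
          exact ⟨k, by
            have := congrArg (fun z : subgroupResKer P N ↦ (z : discreteH1 Hn P)) hk
            simpa only [AddSubgroupClass.coe_nsmul, ZeroMemClass.coe_zero] using this⟩⟩⟩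
      left_inv := fun c ↦ Subtype.ext rfl
      right_inv := fun x ↦ Subtype.ext (Subtype.ext rfl)
      map_add' := fun a b ↦ Subtype.ext (Subtype.ext rfl) }
  exact ⟨(f.trans e₀).trans ep⟩

end Summit.BirchSwinnertonDyer.BirchSwinnertonDyer.Theorems.InputsGreenbergLemma34Layer

end
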